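import Summits.Ventures.Crystal3D.Theorems.StickyWulffConstantGenericWallFloorStarTransport
import Summits.Ventures.Crystal3D.Theorems.StickyWulffConstantGenericWallFloorGlideStarWitness
import Summits.Ventures.Crystal3D.Theorems.StickyWulffConstantGenericWallFloorSlotDozensCubic
import HarnessLib

/-!
# The glide-star row `hcertA` of line `WallLedgerF` is uninhabited (bridge to `not_exactOnly_glideStar583`)

HONEST FRAMING. Part of the venture `Summits/Ventures/Crystal3D` (cell `crystal3d-full`), NEGATIVE knowledge of
record for the crux `CoaxialWallLaw` (stmt-Ventures-19481) of `route-Ventures-StickyWulffConstant`, line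
`WallLedgerF`.  Rung credit only; F-C1 not moved.

`…CoaxialWallLawEndCharge.word_reachable_end_le_eleven` and its carriers (`…ExactInstance`, `…ExactCell`,
`…ExactTwin`, `…EndKFold`, `…SharpInstance`, `…SharpCell`, `…SharpTwin`, `…KFoldTopSplit`) take the hypothesis

  `hcertA : ∀ A n, ‖n‖ = 1 → menu(A, n) → ∀ u ∈ fccSlots, ⟪A u, n⟫ = 0 → ∀ b, ExactOnly b (glide star of (A, n, u) at b)`.

The cell's literature seat refuted the row by an exact witness in the cubic frame
(`…GenericWallFloorGlideStarWitness.not_exactOnly_glideStar583`, lit g13).  This file is the one-isometry bridge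
announced there: **`not_glideStarRow`** — the hypothesis `hcertA`, LITERALLY as typed in those files, is FALSE.
Proof: take `A := L⁻¹` for the isometry `L` carrying the cuboctahedron `fccKissingPattern` onto the slot dozen
(`exists_linearIsometryEquiv_unitShell_eq`), `n := −(1,1,1)/√3`, `u := L((1,−1,0)/√2)`, `b := 0`; then every ball of
the glide star of `(A, n, u)` at `0` is one of the five vectors of `glideStar583` (cubic bookkeeping of
`…GenericWallFloorSlotDozensCubic` + three `decide`s over `fccInt`), so `ExactOnly.mono` would give
`ExactOnly 0 glideStar583`.  Hence every theorem carrying `hcertA` is conditional on a false hypothesis (they remain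
true statements; their content is nil) — the census-free replacements are `…EndDichotomy`, `…PayerInstance`,
`…PayerCell`, `…PayerTwin`.

WHAT THIS IS NOT: nothing about C12-55 (the polar star, certified-running) nor about the crux; F-C1 not moved.
-/

noncomputable section

namespace Summit.Ventures.Crystal3D.Theorems

open Summit.Ventures.Crystal3D Finset
open Literature.Geometry.DiscreteGeometry
open Literature.MathematicalPhysics.StatisticalMechanics (fccStacking)
open scoped InnerProductSpace

/-! ### Cubic-frame plumbing -/

/-- `⟪x, n⟫ = −(x₀ + x₁ + x₂)/√3`. -/
private theorem inner_nneg (x : EuclideanSpace ℝ (Fin 3)) :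
    ⟪x, (-((Real.sqrt 3)⁻¹ • (intVec ![1, 1, 1] : EuclideanSpace ℝ (Fin 3))))⟫_ℝ = -((Real.sqrt 3)⁻¹ * (x 0 + x 1 + x 2)) := by
  rw [inner_neg_right, real_inner_smul_right, real_inner_comm, inner_diag]

/-- `‖n‖ = 1`. -/
private theorem norm_nneg : ‖(-((Real.sqrt 3)⁻¹ • (intVec ![1, 1, 1] : EuclideanSpace ℝ (Fin 3))))‖ = 1 := by
  have h3 : ‖(intVec ![1, 1, 1] : EuclideanSpace ℝ (Fin 3))‖ = Real.sqrt 3 := by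
    rw [← Real.sqrt_sq (norm_nonneg _), norm_diag_sq]
  have hs : (0 : ℝ) < Real.sqrt 3 := by positivity
  rw [norm_neg, norm_smul, norm_inv, Real.norm_of_nonneg hs.le, h3, inv_mul_cancel₀ hs.ne']

/-- `x − 2⟪x, n⟫ n` is the twin reflection across the hexagonal plane. -/
private theorem sub_two_inner_nneg (x : EuclideanSpace ℝ (Fin 3)) :
    x - (2 * ⟪x, (-((Real.sqrt 3)⁻¹ • (intVec ![1, 1, 1] : EuclideanSpace ℝ (Fin 3))))⟫_ℝ) • (-((Real.sqrt 3)⁻¹ • (intVec ![1, 1, 1] : EuclideanSpace ℝ (Fin 3)))) = (ℝ ∙ (intVec ![1, 1, 1] : EuclideanSpace ℝ (Fin 3)))ᗮ.reflection x := by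
  have h3 : (Real.sqrt 3)⁻¹ * (Real.sqrt 3)⁻¹ = 1 / 3 := by
    rw [← mul_inv, Real.mul_self_sqrt (by norm_num : (0 : ℝ) ≤ 3)]; norm_num
  ext i
  rw [twinRefl_apply_coord, inner_nneg]
  simp only [PiLp.sub_apply, PiLp.smul_apply, PiLp.neg_apply, smul_eq_mul, intVec_apply]
  fin_cases i <;> simp <;> linear_combination (2 * (x 0 + x 1 + x 2)) * h3

/-- Coordinate sum of a cubic-frame vector. -/
private theorem sum_cub (v : Fin 3 → ℤ) :
    (((Real.sqrt ((2 : ℕ) : ℝ))⁻¹ • intVec v : EuclideanSpace ℝ (Fin 3))) 0 + (((Real.sqrt ((2 : ℕ) : ℝ))⁻¹ • intVec v : EuclideanSpace ℝ (Fin 3))) 1 + (((Real.sqrt ((2 : ℕ) : ℝ))⁻¹ • intVec v : EuclideanSpace ℝ (Fin 3))) 2 = (Real.sqrt ((2 : ℕ) : ℝ))⁻¹ * ((v 0 + v 1 + v 2 : ℤ) : ℝ) :=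
  sum_coord_scaled _ v

/-- Inner products in the cubic frame: `⟪v/√2, w/√2⟫ = (3v · 3w)/18`. -/
private theorem inner_cub (v w : Fin 3 → ℤ) :
    ⟪(((Real.sqrt ((2 : ℕ) : ℝ))⁻¹ • intVec v : EuclideanSpace ℝ (Fin 3))), (((Real.sqrt ((2 : ℕ) : ℝ))⁻¹ • intVec w : EuclideanSpace ℝ (Fin 3)))⟫_ℝ = ((∑ i, ((3 : ℤ) • v) i * ((3 : ℤ) • w) i : ℤ) : ℝ) / 18 := by
  rw [fcc_scaled_eq, fcc_scaled_eq, inner_scaled18]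

/-- Integer bookkeeping (checked by `decide`): the own closed half of the glide star of `u = (1,−1,0)`. -/
private theorem own_mem_glideStarInt : ∀ v ∈ fccInt,
    (∑ i, ((3 : ℤ) • v) i * ((3 : ℤ) • ![(1 : ℤ), -1, 0]) i : ℤ) = -9 → 0 ≤ v 0 + v 1 + v 2 →
      (3 : ℤ) • v ∈ glideStarInt := by
  decide

/-- Integer bookkeeping (checked by `decide`): the mirror ball of the glide star of `u = (1,−1,0)`. -/
private theorem mirror_mem_glideStarInt : ∀ v ∈ fccInt,
    (∑ i, ((3 : ℤ) • v) i * ((3 : ℤ) • ![(1 : ℤ), -1, 0]) i : ℤ) = -9 → 0 < v 0 + v 1 + v 2 →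
      (3 : ℤ) • v - (2 * (v 0 + v 1 + v 2)) • ![(1 : ℤ), 1, 1] ∈ glideStarInt := by
  decide

/-- Integer bookkeeping (checked by `decide`). -/
private theorem pred_mem_glideStarInt : (3 : ℤ) • ![(-1 : ℤ), 1, 0] ∈ glideStarInt := by decide

/-- Integer bookkeeping (checked by `decide`). -/
private theorem c₀_mem_fccInt : ![(1 : ℤ), -1, 0] ∈ fccInt := by decide

/-! ### The bridge -/

open scoped Classical in
/-- **The glide-star row `hcertA` is false, literally as typed.**  See the module docstring. -/
theorem not_glideStarRow :
    ¬ (∀ (A : EuclideanSpace ℝ (Fin 3) ≃ₗᵢ[ℝ] EuclideanSpace ℝ (Fin 3)) (n : EuclideanSpace ℝ (Fin 3)),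
      ‖n‖ = 1 → (∀ w ∈ fccSlots, ⟪A w, n⟫_ℝ = 0 ∨ ⟪A w, n⟫_ℝ = Real.sqrt (2 / 3) ∨ ⟪A w, n⟫_ℝ = -Real.sqrt (2 / 3)) →
      ∀ u ∈ fccSlots, ⟪A u, n⟫_ℝ = 0 → ∀ b : EuclideanSpace ℝ (Fin 3),
      ExactOnly b (insert (b - A u)
        (((fccSlots.filter fun s => ⟪s, u⟫_ℝ = -(1 / 2) ∧ ⟪A (u + s), n⟫_ℝ ≤ 0).image (fun s => b + A s)) ∪
          ((fccSlots.filter fun s => ⟪s, u⟫_ℝ = -(1 / 2) ∧ ⟪A (u + s), n⟫_ℝ < 0).image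
            (fun s => b + (A s - (2 * ⟪A s, n⟫_ℝ) • n)))))) := by
  intro H
  obtain ⟨L, hL⟩ := exists_linearIsometryEquiv_unitShell_eq
  have h2 : (0 : ℝ) < (Real.sqrt ((2 : ℕ) : ℝ))⁻¹ := by positivity
  have hs3 : (0 : ℝ) < (Real.sqrt 3)⁻¹ := by positivity
  -- slots ↔ cubic vectors
  have toPat : ∀ {s}, s ∈ fccSlots → ∃ v ∈ fccInt, L (((Real.sqrt ((2 : ℕ) : ℝ))⁻¹ • intVec v : EuclideanSpace ℝ (Fin 3))) = s := by
    intro s hs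
    have : s ∈ {w | w ∈ fccStacking 1 (Real.sqrt (2 / 3)) ∧ ‖w‖ = 1} :=
      ⟨mem_fcc_of_mem_fccSlots hs, norm_eq_one_of_mem_fccSlots hs⟩
    rw [hL] at this
    obtain ⟨p, hp, hps⟩ := this
    obtain ⟨v, hv, rfl⟩ := Finset.mem_image.1 (Finset.mem_coe.1 hp)
    exact ⟨v, hv, hps⟩
  have hc : (((Real.sqrt ((2 : ℕ) : ℝ))⁻¹ • intVec ![(1 : ℤ), -1, 0] : EuclideanSpace ℝ (Fin 3))) ∈ fccKissingPattern := Finset.mem_image.2 ⟨_, c₀_mem_fccInt, rfl⟩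
  have hu : L (((Real.sqrt ((2 : ℕ) : ℝ))⁻¹ • intVec ![(1 : ℤ), -1, 0] : EuclideanSpace ℝ (Fin 3))) ∈ fccSlots := by
    have : L (((Real.sqrt ((2 : ℕ) : ℝ))⁻¹ • intVec ![(1 : ℤ), -1, 0] : EuclideanSpace ℝ (Fin 3))) ∈ {w | w ∈ fccStacking 1 (Real.sqrt (2 / 3)) ∧ ‖w‖ = 1} := by
      rw [hL]; exact ⟨_, hc, rfl⟩
    exact mem_fccSlots_of_unit this.1 this.2
  -- the data of the row
  set c : EuclideanSpace ℝ (Fin 3) := (((Real.sqrt ((2 : ℕ) : ℝ))⁻¹ • intVec ![(1 : ℤ), -1, 0] : EuclideanSpace ℝ (Fin 3))) with hcdef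
  have hAu : L.symm (L c) = c := L.symm_apply_apply c
  have hsumc : c 0 + c 1 + c 2 = 0 := by rw [hcdef, sum_cub]; simp
  have hmenu : ∀ w ∈ fccSlots, ⟪L.symm w, (-((Real.sqrt 3)⁻¹ • (intVec ![1, 1, 1] : EuclideanSpace ℝ (Fin 3))))⟫_ℝ = 0 ∨ ⟪L.symm w, (-((Real.sqrt 3)⁻¹ • (intVec ![1, 1, 1] : EuclideanSpace ℝ (Fin 3))))⟫_ℝ = Real.sqrt (2 / 3) ∨
      ⟪L.symm w, (-((Real.sqrt 3)⁻¹ • (intVec ![1, 1, 1] : EuclideanSpace ℝ (Fin 3))))⟫_ℝ = -Real.sqrt (2 / 3) := by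
    intro w hw
    obtain ⟨v, hv, rfl⟩ := toPat hw
    rw [L.symm_apply_apply, inner_nneg]
    have h23 : Real.sqrt (2 / 3) = (Real.sqrt 3)⁻¹ * Real.sqrt 2 := by
      rw [Real.sqrt_div' _ (by norm_num : (0 : ℝ) ≤ 3)]; ring
    rcases sum_coord_of_mem_fcc (Finset.mem_image.2 ⟨v, hv, rfl⟩ : (((Real.sqrt ((2 : ℕ) : ℝ))⁻¹ • intVec v : EuclideanSpace ℝ (Fin 3))) ∈ fccKissingPattern) with h | h | h
    · left; rw [show (((Real.sqrt ((2 : ℕ) : ℝ))⁻¹ • intVec v : EuclideanSpace ℝ (Fin 3))) 0 + (((Real.sqrt ((2 : ℕ) : ℝ))⁻¹ • intVec v : EuclideanSpace ℝ (Fin 3))) 1 + (((Real.sqrt ((2 : ℕ) : ℝ))⁻¹ • intVec v : EuclideanSpace ℝ (Fin 3))) 2 = 0 from h]; ring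
    · right; right; rw [show (((Real.sqrt ((2 : ℕ) : ℝ))⁻¹ • intVec v : EuclideanSpace ℝ (Fin 3))) 0 + (((Real.sqrt ((2 : ℕ) : ℝ))⁻¹ • intVec v : EuclideanSpace ℝ (Fin 3))) 1 + (((Real.sqrt ((2 : ℕ) : ℝ))⁻¹ • intVec v : EuclideanSpace ℝ (Fin 3))) 2 = Real.sqrt 2 from h, h23]
    · right; left; rw [show (((Real.sqrt ((2 : ℕ) : ℝ))⁻¹ • intVec v : EuclideanSpace ℝ (Fin 3))) 0 + (((Real.sqrt ((2 : ℕ) : ℝ))⁻¹ • intVec v : EuclideanSpace ℝ (Fin 3))) 1 + (((Real.sqrt ((2 : ℕ) : ℝ))⁻¹ • intVec v : EuclideanSpace ℝ (Fin 3))) 2 = -Real.sqrt 2 from h, h23]; ring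
  have hun : ⟪L.symm (L c), (-((Real.sqrt 3)⁻¹ • (intVec ![1, 1, 1] : EuclideanSpace ℝ (Fin 3))))⟫_ℝ = 0 := by rw [hAu, inner_nneg, hsumc]; ring
  have key := H L.symm (-((Real.sqrt 3)⁻¹ • (intVec ![1, 1, 1] : EuclideanSpace ℝ (Fin 3)))) norm_nneg hmenu (L c) hu hun 0
  -- every ball of the row's pattern is one of the five vectors of `glideStar583`
  refine not_exactOnly_glideStar583 (key.mono ?_)
  intro x hx
  rw [Finset.mem_insert, Finset.mem_union] at hx
  -- integer data of a slot `s` with `⟪s, u⟫ = −½`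
  have hdata : ∀ {s}, s ∈ fccSlots → ⟪s, L c⟫_ℝ = -(1 / 2) → ∃ v ∈ fccInt, L (((Real.sqrt ((2 : ℕ) : ℝ))⁻¹ • intVec v : EuclideanSpace ℝ (Fin 3))) = s ∧
      (∑ i, ((3 : ℤ) • v) i * ((3 : ℤ) • ![(1 : ℤ), -1, 0]) i : ℤ) = -9 ∧
      ⟪L.symm (L c + s), (-((Real.sqrt 3)⁻¹ • (intVec ![1, 1, 1] : EuclideanSpace ℝ (Fin 3))))⟫_ℝ = -((Real.sqrt 3)⁻¹ * ((Real.sqrt ((2 : ℕ) : ℝ))⁻¹ * ((v 0 + v 1 + v 2 : ℤ) : ℝ))) := by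
    intro s hs hsu
    obtain ⟨v, hv, rfl⟩ := toPat hs
    refine ⟨v, hv, rfl, ?_, ?_⟩
    · rw [LinearIsometryEquiv.inner_map_map, hcdef, inner_cub] at hsu
      have : ((∑ i, ((3 : ℤ) • v) i * ((3 : ℤ) • ![(1 : ℤ), -1, 0]) i : ℤ) : ℝ) = -9 := by linarith
      exact_mod_cast this
    · rw [← map_add, L.symm_apply_apply, inner_nneg]
      simp only [PiLp.add_apply]
      rw [show c 0 + (((Real.sqrt ((2 : ℕ) : ℝ))⁻¹ • intVec v : EuclideanSpace ℝ (Fin 3))) 0 + (c 1 + (((Real.sqrt ((2 : ℕ) : ℝ))⁻¹ • intVec v : EuclideanSpace ℝ (Fin 3))) 1) + (c 2 + (((Real.sqrt ((2 : ℕ) : ℝ))⁻¹ • intVec v : EuclideanSpace ℝ (Fin 3))) 2) = (c 0 + c 1 + c 2) + ((((Real.sqrt ((2 : ℕ) : ℝ))⁻¹ • intVec v : EuclideanSpace ℝ (Fin 3))) 0 + (((Real.sqrt ((2 : ℕ) : ℝ))⁻¹ • intVec v : EuclideanSpace ℝ (Fin 3))) 1 + (((Real.sqrt ((2 : ℕ)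 : ℝ))⁻¹ • intVec v : EuclideanSpace ℝ (Fin 3))) 2)
        by ring, hsumc, zero_add, sum_cub]
  rcases hx with rfl | hx | hx
  · -- the predecessor `−u = (−1,1,0)/√2`
    rw [zero_sub, hAu, hcdef]
    refine Finset.mem_image.2 ⟨_, pred_mem_glideStarInt, ?_⟩
    rw [← fcc_scaled_eq, ← smul_neg]
    congr 1
    ext i; fin_cases i <;> simp [intVec_apply]
  · -- an own ball `A s`, `⟪s, u⟫ = −½`, on the closed own side
    obtain ⟨s, hs, rfl⟩ := Finset.mem_image.1 hx
    obtain ⟨hsS, hsu, hle⟩ := Finset.mem_filter.1 hs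
    obtain ⟨v, hv, rfl, hdot, hsum⟩ := hdata hsS hsu
    rw [hsum] at hle
    have hv0 : (0 : ℤ) ≤ v 0 + v 1 + v 2 := by
      have : 0 ≤ (Real.sqrt 3)⁻¹ * ((Real.sqrt ((2 : ℕ) : ℝ))⁻¹ * ((v 0 + v 1 + v 2 : ℤ) : ℝ)) := by linarith
      have := (mul_nonneg_iff_of_pos_left hs3).1 this
      exact_mod_cast (mul_nonneg_iff_of_pos_left h2).1 this
    rw [zero_add, L.symm_apply_apply]
    refine Finset.mem_image.2 ⟨_, own_mem_glideStarInt v hv hdot hv0, ?_⟩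
    rw [← fcc_scaled_eq]
  · -- a mirror ball `A s − 2⟪A s, n⟫ n`, `⟪s, u⟫ = −½`, strictly on the own side
    obtain ⟨s, hs, rfl⟩ := Finset.mem_image.1 hx
    obtain ⟨hsS, hsu, hlt⟩ := Finset.mem_filter.1 hs
    obtain ⟨v, hv, rfl, hdot, hsum⟩ := hdata hsS hsu
    rw [hsum] at hlt
    have hv0 : (0 : ℤ) < v 0 + v 1 + v 2 := by
      have : 0 < (Real.sqrt 3)⁻¹ * ((Real.sqrt ((2 : ℕ) : ℝ))⁻¹ * ((v 0 + v 1 + v 2 : ℤ) : ℝ)) := by linarith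
      have := (mul_pos_iff_of_pos_left hs3).1 this
      exact_mod_cast (mul_pos_iff_of_pos_left h2).1 this
    rw [zero_add, L.symm_apply_apply, sub_two_inner_nneg]
    refine Finset.mem_image.2 ⟨_, mirror_mem_glideStarInt v hv hdot hv0, ?_⟩
    rw [← twinRefl_fcc_scaled_eq]

end Summit.Ventures.Crystal3D.Theorems

end
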